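import Summits.RiemannHypothesis.RiemannHypothesis.Theorems.WeilLegendreBlocks136DataC3
import Summits.RiemannHypothesis.RiemannHypothesis.Theorems.WeilLegendreBlocks136DataD1
import HarnessLib

/-!
# Odd Legendre blocks at `nb = 136`: the `WeilCert` block base (`N = 271`)

The odd Legendre block provider at `nb = 136` (`N = 271`) for the deflated two-prime certificates (Yoshida moment format `WeilCert`/`WeilCert23` [cite: Yoshida1992, §6, Thm 1 p. 310]) of the parity-ladder cells beyond `a₀ ≈ 0.785`, where the `N = 255` format of certificate H fails (Taylor remainder `2(a₀T)^{N+1}/(N+1)!`).  Rows `0..127` of `C` (monomial coefficients of `P_{2j+1}`) and of `D = C⁻¹` are those of certificate H (`weilCert23HCR*`, `weilCert23HDR*`, reused by name — they do not depend on `nb`); rows `128..135`, the factored inverse `Dn/Ls` (which does depend on `nb`) and all `136` row checks are new.  Generated by exact rational arithmetic (`cert/gen_n271.py`, GroundBarta rung-4 prover A g5); nothing about the data is trusted: only kernel-evaluated Booleans are consumed (`sharedRows_weilBlocks136`).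
Only the fields `N` (hence `nb = 136`), `CO`, `DO` are used (`WeilCert.checkDCRow`, `WeilCert.checkDnRow`, and by definitional transfer every certificate with the same `N`, `CO`, `DO`); the other fields are placeholders.
-/

noncomputable section

set_option linter.dupNamespace false

namespace Summit.RiemannHypothesis.RiemannHypothesis.Theorems.EvenWinsBeyondArch

open Literature.NumberTheory.LFunctions

/-- The block base at `nb = 136`: `N = 271`, odd blocks `C`, `D`; all other fields are placeholders (unused by the row checks). [folklore] -/
def weilBlocks136Base : WeilCert where
  a0 := 4023/5000
  N := 271
  T := 120
  wL := 0
  mwT := 40000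
  prec := 120
  pg := 128
  cells := []
  CE := []
  CO := weilBlocks136C
  DE := []
  DO := weilBlocks136D
  UE := []
  UO := []

/-- `nb = 136` for the block base. [folklore] -/
theorem weilBlocks136Base_nb : weilBlocks136Base.nb = 136 := rfl

end Summit.RiemannHypothesis.RiemannHypothesis.Theorems.EvenWinsBeyondArch
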